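import Summits.QuantumFields.YangMills.Theorems.FemtoCutoffLadderThinningHolonomy
import Summits.QuantumFields.YangMills.Theorems.LuscherReductionRunningReductionLatticeTopLower
import Literature.MathematicalPhysics.QuantumFieldTheory.ConstructiveQFTWave0Proofs
import HarnessLib

/-!
# Route `FemtoCutoffLadder` — THINNING IS SMALL-FIELD STABLE: a plaquette of the thinned configuration is a fine `a × b` Wilson loop,
# `a, b ∈ {1, 2}`, and its magnetic energy is at most `4 ×` the energy of the `≤ 4` fine plaquettes it encloses (`SU(2)`)

Seat `ym-line-fcl-p3` g6 (2026-08-28).  Rung R2b1 = the RECORD-label femto transfer gap — NOT infinite volume, NOT the Clay mass gap; no summit and no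
step of the route is proved by this module.

Context.  The pinned engine `PinnedUpStep` (stmt-QuantumFields-26925) of the variational incommensurable step `UpStepEv` (stmt-QuantumFields-26796)
transports the coarse first excitation to the fine lattice along the thinning map `Thinning.thin L'` (`FemtoCutoffLadderThinningDefs`,
`L' ≤ L ≤ 2L'`).  `FemtoCutoffLadderThinningHolonomy` proved that NON-contractible straight loops pull back EXACTLY (H1/H2).  Contractible loops do
not: this module records what happens to PLAQUETTES, the gauge-invariant small-field datum of every Bałaban-type analysis a supplier of 26925 would run.

* §1 (any group `G`, any `d`; shifts commute by the tree's `WilsonRP.shift_comm`) `plaquetteHolonomy_eq_transport` (a plaquette is the path pair `[i,j]·[j,i]⁻¹`), `transport_thin_pair`, and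
  ★ `plaquetteHolonomy_thin`: the coarse plaquette at `x'` in the plane `(i, j)`, read on `thin L' U`, is the fine RECTANGULAR Wilson loop
  `P_U(ιx'; i^a j^b) · P_U(ιx'; j^b i^a)⁻¹` with `a = thinSteps (x'_i)`, `b = thinSteps (x'_j)` ∈ `{1, 2}` (the thinning paths of the two
  `i`-sides start at `ι x'` and `ι(x' + e_j) = ι x' + b e_j`, `thinSite_shift`).
* §2 (`SU(2)`, fundamental trace; namespace `FemtoTransferGap`) the deficit `e(W) = 2 − Re tr W = ‖W − 1‖²_F / 2` (tree `two_sub_re_trace_eq`) satisfies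
  the path-pair TRIANGLE inequality `e(PQ⁻¹) ≤ 2e(PR⁻¹) + 2e(RQ⁻¹)` (`two_sub_re_trace_mul_inv_le`, from the tree's `frobNorm_mul_sub_one_le`), is
  conjugation- and inversion-invariant and non-negative; whence the rectangle bounds `two_sub_re_trace_rect21_le` / `…rect12_le` (`≤ 2e + 2e`) and
  `…rect22_le` (`≤ 4 Σ_{4 plaquettes} e`) by inserting intermediate lattice paths.
* §3 ★★ `two_sub_re_trace_plaquette_thin_le`: `e(plaquette of thin L' U at (x'; i, j)) ≤ 4 · Σ_{s<a, t<b} e(plaquette of U at (ιx' + s e_i + t e_j; i, j))`;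
  ★ `two_sub_re_trace_plaquette_thin_le_of_forall`: if every fine plaquette has `e ≤ ε` then every plaquette of the thinned field has `e ≤ 16 ε`
  (thinning maps the fine small-field region into the coarse one); `frobNorm_thin_sub_one_le`: link-wise, `‖(thin L' U)_{e'} − 1‖_F ≤ 2r` when all
  `‖U_e − 1‖_F ≤ r`.

What is NOT here: the global sum `S(thin L' U) ≤ 4 S(U)` (needs the tiling/injectivity bookkeeping of the rectangles; not needed pointwise), anything
about measures or dynamics.  No definitions, no named facts, no `sorry`.
-/

set_option autoImplicit false

noncomputable section

open Literature.MathematicalPhysics.QuantumFieldTheory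
open Literature.MathematicalPhysics.QuantumLattice

/-! ## §1 Plaquettes as path pairs; plaquettes of the thinned configuration are fine rectangles -/

namespace Summit.QuantumFields.YangMills.Theorems.FemtoCutoffLadder.Thinning

open Summit.QuantumFields.YangMills.Theorems.FemtoTransferGap

section Generic

variable {d L L' : ℕ} {G : Type*} [Group G]

/-- **A plaquette is a path pair**: `U_p(x; i, j) = P_U(x; [i, j]) · P_U(x; [j, i])⁻¹` (two two-link paths from `x` to `x + eᵢ + eⱼ`). [folklore] -/
theorem plaquetteHolonomy_eq_transport (U : GaugeConfig d L G) (x : Site d L) (i j : Fin d) :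
    plaquetteHolonomy U x i j = transport U x [i, j] * (transport U x [j, i])⁻¹ := by
  simp only [plaquetteHolonomy, transport_cons, transport_nil, mul_one, mul_inv_rev, mul_assoc]

variable [NeZero L']

/-- The coarse two-link path `[i, j]` (`i ≠ j`) from `x'`, read on `thin L' U`, is the fine path `i^a j^b` from `ι x'`
(`a = thinSteps x'_i`, `b = thinSteps x'_j`; the `j`-side starts at `ι(x' + eᵢ) = ι x' + a eᵢ`, `thinSite_shift`). [folklore] -/
theorem transport_thin_pair (hLL : L' ≤ L) (h2 : L ≤ 2 * L') (U : GaugeConfig d L G) (x' : Site d L') {i j : Fin d} (hij : i ≠ j) :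
    transport (thin L' U) x' [i, j] =
      transport U (thinSite L x') (List.replicate (thinSteps L L' (x' i)) i ++ List.replicate (thinSteps L L' (x' j)) j) := by
  have hj : (x'.shift i) j = x' j := by
    simp only [Site.shift, Pi.add_apply, Pi.single_apply, if_neg hij.symm, add_zero]
  rw [transport_cons, transport_cons, transport_nil, mul_one, transport_append, ← thinSite_shift hLL h2 x' i]
  simp only [thin, hj]

/-- ★ **Plaquettes of the thinned configuration are fine rectangles**: for `i ≠ j` the coarse plaquette at `x'` in the plane `(i, j)` of
`thin L' U` is the fine `a × b` Wilson loop `P_U(ιx'; i^a j^b) · P_U(ιx'; j^b i^a)⁻¹`, `a = thinSteps x'_i`, `b = thinSteps x'_j` (each `1` or `2`). [folklore] -/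
theorem plaquetteHolonomy_thin (hLL : L' ≤ L) (h2 : L ≤ 2 * L') (U : GaugeConfig d L G) (x' : Site d L') {i j : Fin d} (hij : i ≠ j) :
    plaquetteHolonomy (thin L' U) x' i j =
      transport U (thinSite L x') (List.replicate (thinSteps L L' (x' i)) i ++ List.replicate (thinSteps L L' (x' j)) j) *
        (transport U (thinSite L x') (List.replicate (thinSteps L L' (x' j)) j ++ List.replicate (thinSteps L L' (x' i)) i))⁻¹ := by
  rw [plaquetteHolonomy_eq_transport, transport_thin_pair hLL h2 U x' hij, transport_thin_pair hLL h2 U x' hij.symm]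

end Generic

end Summit.QuantumFields.YangMills.Theorems.FemtoCutoffLadder.Thinning

/-! ## §2 `SU(2)`: the plaquette deficit `2 − Re tr` along path pairs, and rectangle bounds -/

namespace Summit.QuantumFields.YangMills.Theorems.FemtoTransferGap


section Deficit

variable {d L : ℕ}

/-- `0 ≤ 2 − Re tr W` on `SU(2)`. [folklore] -/
theorem two_sub_re_trace_nonneg (W : SU2) : 0 ≤ 2 - ((su2Rep W).trace).re := by
  rw [fundamentalRep_apply]; linarith [re_trace_le_two W]

/-- Conjugation invariance: `2 − Re tr(h W h⁻¹) = 2 − Re tr W` (cyclicity of the trace). [folklore] -/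
theorem two_sub_re_trace_conj (h W : SU2) : 2 - ((su2Rep (h * W * h⁻¹)).trace).re = 2 - ((su2Rep W).trace).re := by
  rw [map_mul, map_mul, Matrix.trace_mul_cycle, ← map_mul, inv_mul_cancel, map_one, one_mul]

/-- Inversion invariance: `2 − Re tr W⁻¹ = 2 − Re tr W` on `SU(2)`. [folklore] -/
theorem two_sub_re_trace_inv (W : SU2) : 2 - ((su2Rep W⁻¹).trace).re = 2 - ((su2Rep W).trace).re := by
  rw [fundamentalRep_apply, fundamentalRep_apply, two_sub_re_trace_eq, two_sub_re_trace_eq, frobNorm_inv_sub_one]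

/-- **Path-pair triangle inequality for the plaquette deficit**: `2 − Re tr(PQ⁻¹) ≤ 2(2 − Re tr(PR⁻¹)) + 2(2 − Re tr(RQ⁻¹))` on `SU(2)` — since
`2 − Re tr W = ‖W − 1‖²_F/2`, `PQ⁻¹ = (PR⁻¹)(RQ⁻¹)` and `‖XY − 1‖_F ≤ ‖X − 1‖_F + ‖Y − 1‖_F`.  Inserting an intermediate lattice path `R`
between two paths `P`, `Q` with common endpoints splits a Wilson loop into two. [cite: HornJohnson2013, Thm 2.2.2] -/
theorem two_sub_re_trace_mul_inv_le (P Q R : SU2) :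
    2 - ((su2Rep (P * Q⁻¹)).trace).re ≤ 2 * (2 - ((su2Rep (P * R⁻¹)).trace).re) + 2 * (2 - ((su2Rep (R * Q⁻¹)).trace).re) := by
  have hPQ : P * Q⁻¹ = (P * R⁻¹) * (R * Q⁻¹) := by group
  rw [fundamentalRep_apply, fundamentalRep_apply, fundamentalRep_apply, two_sub_re_trace_eq, two_sub_re_trace_eq, two_sub_re_trace_eq, hPQ]
  have h := frobNorm_mul_sub_one_le (P * R⁻¹) (R * Q⁻¹)
  have h0 := frobNorm_nonneg (((P * R⁻¹ : SU2) : Matrix (Fin 2) (Fin 2) ℂ) - 1)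
  have h1 := frobNorm_nonneg (((R * Q⁻¹ : SU2) : Matrix (Fin 2) (Fin 2) ℂ) - 1)
  have h2 := frobNorm_nonneg ((((P * R⁻¹) * (R * Q⁻¹) : SU2) : Matrix (Fin 2) (Fin 2) ℂ) - 1)
  have hsq := pow_le_pow_left₀ h2 h 2
  nlinarith [hsq, sq_nonneg (frobNorm (((P * R⁻¹ : SU2) : Matrix (Fin 2) (Fin 2) ℂ) - 1) -
    frobNorm (((R * Q⁻¹ : SU2) : Matrix (Fin 2) (Fin 2) ℂ) - 1))]

/-- **`2 × 1` rectangle**: the loop `[i,i,j]·[j,i,i]⁻¹` at `x` costs at most `2 e(x + eᵢ) + 2 e(x)` (intermediate path `[i,j,i]`: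
`[i,i,j][i,j,i]⁻¹ = U(x,i)·U_p(x+eᵢ)·U(x,i)⁻¹`, `[i,j,i][j,i,i]⁻¹ = U_p(x)`). [folklore] -/
theorem two_sub_re_trace_rect21_le (U : GaugeConfig d L SU2) (x : Site d L) (i j : Fin d) :
    2 - ((su2Rep (transport U x [i, i, j] * (transport U x [j, i, i])⁻¹)).trace).re ≤
      2 * (2 - ((su2Rep (plaquetteHolonomy U (x.shift i) i j)).trace).re) +
        2 * (2 - ((su2Rep (plaquetteHolonomy U x i j)).trace).re) := by
  have key := two_sub_re_trace_mul_inv_le (transport U x [i, i, j]) (transport U x [j, i, i]) (transport U x [i, j, i])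
  have hPR : transport U x [i, i, j] * (transport U x [i, j, i])⁻¹ =
      U (x, i) * plaquetteHolonomy U (x.shift i) i j * (U (x, i))⁻¹ := by
    simp only [transport_cons, transport_nil, mul_one, plaquetteHolonomy]
    group
  have hRQ : transport U x [i, j, i] * (transport U x [j, i, i])⁻¹ = plaquetteHolonomy U x i j := by
    simp only [transport_cons, transport_nil, mul_one, plaquetteHolonomy, WilsonRP.shift_comm x i j]
    group
  rw [hPR, two_sub_re_trace_conj, hRQ] at key
  exact key

/-- **`1 × 2` rectangle**: the loop `[i,j,j]·[j,j,i]⁻¹` at `x` costs at most `2 e(x) + 2 e(x + eⱼ)` (intermediate path `[j,i,j]`). [folklore] -/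
theorem two_sub_re_trace_rect12_le (U : GaugeConfig d L SU2) (x : Site d L) (i j : Fin d) :
    2 - ((su2Rep (transport U x [i, j, j] * (transport U x [j, j, i])⁻¹)).trace).re ≤
      2 * (2 - ((su2Rep (plaquetteHolonomy U x i j)).trace).re) +
        2 * (2 - ((su2Rep (plaquetteHolonomy U (x.shift j) i j)).trace).re) := by
  have key := two_sub_re_trace_mul_inv_le (transport U x [i, j, j]) (transport U x [j, j, i]) (transport U x [j, i, j])
  have hPR : transport U x [i, j, j] * (transport U x [j, i, j])⁻¹ = plaquetteHolonomy U x i j := by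
    simp only [transport_cons, transport_nil, mul_one, plaquetteHolonomy, WilsonRP.shift_comm x i j]
    group
  have hRQ : transport U x [j, i, j] * (transport U x [j, j, i])⁻¹ =
      U (x, j) * plaquetteHolonomy U (x.shift j) i j * (U (x, j))⁻¹ := by
    simp only [transport_cons, transport_nil, mul_one, plaquetteHolonomy]
    group
  rw [hPR, hRQ, two_sub_re_trace_conj] at key
  exact key

/-- **`2 × 2` square**: the loop `[i,i,j,j]·[j,j,i,i]⁻¹` at `x` costs at most `4 Σ` of the four plaquette deficits at `x`, `x + eᵢ`, `x + eⱼ`,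
`x + eᵢ + eⱼ` (intermediate path `[j,i,i,j]` splits it into the `2 × 1` rectangles at `x` and, conjugated by `U(x,j)`, at `x + eⱼ`). [folklore] -/
theorem two_sub_re_trace_rect22_le (U : GaugeConfig d L SU2) (x : Site d L) (i j : Fin d) :
    2 - ((su2Rep (transport U x [i, i, j, j] * (transport U x [j, j, i, i])⁻¹)).trace).re ≤
      4 * ((2 - ((su2Rep (plaquetteHolonomy U x i j)).trace).re) +
        (2 - ((su2Rep (plaquetteHolonomy U (x.shift i) i j)).trace).re) +
        (2 - ((su2Rep (plaquetteHolonomy U (x.shift j) i j)).trace).re) +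
        (2 - ((su2Rep (plaquetteHolonomy U ((x.shift i).shift j) i j)).trace).re)) := by
  have key := two_sub_re_trace_mul_inv_le (transport U x [i, i, j, j]) (transport U x [j, j, i, i]) (transport U x [j, i, i, j])
  have h3 : ((x.shift i).shift i).shift j = ((x.shift j).shift i).shift i := by
    rw [WilsonRP.shift_comm (x.shift i) i j, WilsonRP.shift_comm x i j]
  have hPR : transport U x [i, i, j, j] * (transport U x [j, i, i, j])⁻¹ =
      transport U x [i, i, j] * (transport U x [j, i, i])⁻¹ := by
    simp only [transport_cons, transport_nil, mul_one, h3]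
    group
  have hRQ : transport U x [j, i, i, j] * (transport U x [j, j, i, i])⁻¹ =
      U (x, j) * (transport U (x.shift j) [i, i, j] * (transport U (x.shift j) [j, i, i])⁻¹) * (U (x, j))⁻¹ := by
    simp only [transport_cons, transport_nil, mul_one]
    group
  rw [hPR, hRQ, two_sub_re_trace_conj] at key
  have hA := two_sub_re_trace_rect21_le U x i j
  have hB := two_sub_re_trace_rect21_le U (x.shift j) i j
  rw [← WilsonRP.shift_comm x i j] at hB
  linarith

end Deficit

end Summit.QuantumFields.YangMills.Theorems.FemtoTransferGap

/-! ## §3 Thinning maps small fields to small fields -/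

namespace Summit.QuantumFields.YangMills.Theorems.FemtoCutoffLadder.Thinning

open Summit.QuantumFields.YangMills.Theorems.FemtoTransferGap

section SmallField

variable {d L L' : ℕ} [NeZero L']

/-- ★★ **Plaquette energies of the thinned field are controlled by the enclosed fine plaquettes**: for `L' ≤ L ≤ 2L'`, `i ≠ j`,
`2 − Re tr U_p(thin L' U; x', i, j) ≤ 4 · Σ_{s < a} Σ_{t < b} (2 − Re tr U_p(U; ιx' + s eᵢ + t eⱼ, i, j))`, `a = thinSteps x'_i`, `b = thinSteps x'_j`
(the thinned plaquette is the fine `a × b` rectangle at `ι x'`, `plaquetteHolonomy_thin`; rectangles are bounded by §2). [folklore] -/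
theorem two_sub_re_trace_plaquette_thin_le (hLL : L' ≤ L) (h2 : L ≤ 2 * L') (U : GaugeConfig d L SU2) (x' : Site d L') {i j : Fin d}
    (hij : i ≠ j) :
    2 - ((su2Rep (plaquetteHolonomy (thin L' U) x' i j)).trace).re ≤
      4 * ∑ s ∈ Finset.range (thinSteps L L' (x' i)), ∑ t ∈ Finset.range (thinSteps L L' (x' j)),
        (2 - ((su2Rep (plaquetteHolonomy U
          (thinSite L x' + Pi.single i ((s : ℕ) : ZMod L) + Pi.single j ((t : ℕ) : ZMod L)) i j)).trace).re) := by
  rw [plaquetteHolonomy_thin hLL h2 U x' hij]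
  set x : Site d L := thinSite L x' with hx
  have e00 : x + Pi.single i ((0 : ℕ) : ZMod L) + Pi.single j ((0 : ℕ) : ZMod L) = x := by
    simp only [Nat.cast_zero, Pi.single_zero, add_zero]
  have e10 : x + Pi.single i ((1 : ℕ) : ZMod L) + Pi.single j ((0 : ℕ) : ZMod L) = x.shift i := by
    simp only [Nat.cast_one, Nat.cast_zero, Pi.single_zero, add_zero, Site.shift]
  have e01 : x + Pi.single i ((0 : ℕ) : ZMod L) + Pi.single j ((1 : ℕ) : ZMod L) = x.shift j := by
    simp only [Nat.cast_zero, Nat.cast_one, Pi.single_zero, add_zero, Site.shift]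
  have e11 : x + Pi.single i ((1 : ℕ) : ZMod L) + Pi.single j ((1 : ℕ) : ZMod L) = (x.shift i).shift j := by
    simp only [Nat.cast_one, Site.shift]
  have hn := fun (y : Site d L) => two_sub_re_trace_nonneg (plaquetteHolonomy U y i j)
  unfold thinSteps
  by_cases ha : (x' i).val < L - L' <;> by_cases hb : (x' j).val < L - L'
  · -- `2 × 2`
    simp only [if_pos ha, if_pos hb, Finset.sum_range_succ, Finset.sum_range_zero, zero_add, e00, e10, e01, e11]
    have h := two_sub_re_trace_rect22_le U x i j
    have hrep : (List.replicate 2 i ++ List.replicate 2 j) = [i, i, j, j] := rfl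
    have hrep' : (List.replicate 2 j ++ List.replicate 2 i) = [j, j, i, i] := rfl
    rw [hrep, hrep']
    linarith
  · -- `2 × 1`
    simp only [if_pos ha, if_neg hb, Finset.sum_range_succ, Finset.sum_range_zero, zero_add, e00, e10]
    have h := two_sub_re_trace_rect21_le U x i j
    have hrep : (List.replicate 2 i ++ List.replicate 1 j) = [i, i, j] := rfl
    have hrep' : (List.replicate 1 j ++ List.replicate 2 i) = [j, i, i] := rfl
    rw [hrep, hrep']
    linarith [hn x, hn (x.shift i)]
  · -- `1 × 2`
    simp only [if_neg ha, if_pos hb, Finset.sum_range_succ, Finset.sum_range_zero, zero_add, e00, e01]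
    have h := two_sub_re_trace_rect12_le U x i j
    have hrep : (List.replicate 1 i ++ List.replicate 2 j) = [i, j, j] := rfl
    have hrep' : (List.replicate 2 j ++ List.replicate 1 i) = [j, j, i] := rfl
    rw [hrep, hrep']
    linarith [hn x, hn (x.shift j)]
  · -- `1 × 1`: the plaquette itself
    simp only [if_neg ha, if_neg hb, Finset.sum_range_succ, Finset.sum_range_zero, zero_add, e00]
    have hrep : (List.replicate 1 i ++ List.replicate 1 j) = [i, j] := rfl
    have hrep' : (List.replicate 1 j ++ List.replicate 1 i) = [j, i] := rfl
    rw [hrep, hrep', ← plaquetteHolonomy_eq_transport]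
    linarith [hn x]

/-- ★ **Thinning maps the fine small-field region into the coarse one**: if every fine plaquette in the plane `(i, j)` has deficit
`2 − Re tr ≤ ε`, then every plaquette of `thin L' U` in that plane has deficit `≤ 16 ε`. [folklore] -/
theorem two_sub_re_trace_plaquette_thin_le_of_forall (hLL : L' ≤ L) (h2 : L ≤ 2 * L') (U : GaugeConfig d L SU2) {i j : Fin d}
    (hij : i ≠ j) {ε : ℝ} (hε : ∀ y : Site d L, 2 - ((su2Rep (plaquetteHolonomy U y i j)).trace).re ≤ ε) (x' : Site d L') :
    2 - ((su2Rep (plaquetteHolonomy (thin L' U) x' i j)).trace).re ≤ 16 * ε := by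
  have hε0 : 0 ≤ ε := (two_sub_re_trace_nonneg _).trans (hε (thinSite L x'))
  have ha : thinSteps L L' (x' i) ≤ 2 := by unfold thinSteps; split_ifs <;> omega
  have hb : thinSteps L L' (x' j) ≤ 2 := by unfold thinSteps; split_ifs <;> omega
  refine (two_sub_re_trace_plaquette_thin_le hLL h2 U x' hij).trans ?_
  have hinner : ∀ s : ℕ, ∑ t ∈ Finset.range (thinSteps L L' (x' j)),
      (2 - ((su2Rep (plaquetteHolonomy U
        (thinSite L x' + Pi.single i ((s : ℕ) : ZMod L) + Pi.single j ((t : ℕ) : ZMod L)) i j)).trace).re) ≤ 2 * ε := by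
    intro s
    calc ∑ t ∈ Finset.range (thinSteps L L' (x' j)),
          (2 - ((su2Rep (plaquetteHolonomy U
            (thinSite L x' + Pi.single i ((s : ℕ) : ZMod L) + Pi.single j ((t : ℕ) : ZMod L)) i j)).trace).re)
        ≤ ∑ _t ∈ Finset.range (thinSteps L L' (x' j)), ε := Finset.sum_le_sum fun t _ => hε _
      _ = thinSteps L L' (x' j) * ε := by rw [Finset.sum_const, Finset.card_range, nsmul_eq_mul]
      _ ≤ 2 * ε := by
          refine mul_le_mul_of_nonneg_right ?_ hε0
          exact_mod_cast hb
  calc 4 * ∑ s ∈ Finset.range (thinSteps L L' (x' i)), ∑ t ∈ Finset.range (thinSteps L L' (x' j)),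
        (2 - ((su2Rep (plaquetteHolonomy U
          (thinSite L x' + Pi.single i ((s : ℕ) : ZMod L) + Pi.single j ((t : ℕ) : ZMod L)) i j)).trace).re)
      ≤ 4 * ∑ _s ∈ Finset.range (thinSteps L L' (x' i)), 2 * ε := by
        refine mul_le_mul_of_nonneg_left (Finset.sum_le_sum fun s _ => hinner s) (by norm_num)
    _ = 4 * (thinSteps L L' (x' i) * (2 * ε)) := by rw [Finset.sum_const, Finset.card_range, nsmul_eq_mul]
    _ ≤ 4 * (2 * (2 * ε)) := by
        refine mul_le_mul_of_nonneg_left (mul_le_mul_of_nonneg_right ?_ (by positivity)) (by norm_num)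
        exact_mod_cast ha
    _ = 16 * ε := by ring

omit [NeZero L'] in
/-- Link-wise small-field stability: if every fine link is within `r` of `1` in Frobenius norm, every link of `thin L' U` is within `2r`
(a thinned link is one fine link or the product of two; `frobNorm_mul_sub_one_le`). [folklore] -/
theorem frobNorm_thin_sub_one_le (U : GaugeConfig d L SU2) {r : ℝ}
    (hr : ∀ e : Edge d L, frobNorm ((U e : Matrix (Fin 2) (Fin 2) ℂ) - 1) ≤ r) (e' : Edge d L') :
    frobNorm (((thin L' U e' : SU2) : Matrix (Fin 2) (Fin 2) ℂ) - 1) ≤ 2 * r := by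
  have hr0 : 0 ≤ r := (frobNorm_nonneg _).trans (hr (thinSite L e'.1, e'.2))
  obtain ⟨x', i⟩ := e'
  rw [thin_apply]
  split_ifs with h
  · have h1 := frobNorm_mul_sub_one_le (U (thinSite L x', i)) (U ((thinSite L x').shift i, i))
    linarith [hr (thinSite L x', i), hr ((thinSite L x').shift i, i)]
  · linarith [hr (thinSite L x', i)]

end SmallField

end Summit.QuantumFields.YangMills.Theorems.FemtoCutoffLadder.Thinning

end
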